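import Mathlib
import HarnessLib
import Summits.ResolutionOfSingularities.ResolutionOfSingularities.Theorems.WildQuotientsWildQuotientResolutionS1aAuxOrbit
import Summits.ResolutionOfSingularities.ResolutionOfSingularities.Theorems.WildQuotientsWildQuotientResolutionS1aAuxSupportTop

/-!
# S1a — NECESSITY OF THE ORBIT SUPPORT CLAUSE: a move that lowers `(jInf, topCount)` lexicographically has a top non-killable component INSIDE its support

[OURS · L1 W4.5c · lead-1 g9; plan-1 g12 menu item (a): the `topCount` twin of (A0) `auxCentreContainsTopField` p618292] — NOT statements of the manuscript;
counted 0; AI-level work, weaker than expert review. Crux stmt-ResolutionOfSingularities-17941, line `s1a-logminvertex` v10; negative knowledge for the A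
stub `stub_auxWithinReachAux` (orbit form). Route-independent.

For models of finite type over a field and an admissible move `M → M′` along a centre with `G`-stable piece `𝒦_d`:
* ★ `exists_isEmbedding_nonKillable_diff_support` — the non-killable points of `M` OFF the support EMBED into `nonKillable M′` (the inducing map of
  `exists_isInducing_nonKillable_inter`, p617035, is injective);
* ★★ `topCount_le_of_forall_not_subset` — if NO top-dimensional component of `nonKillable M` lies inside `supp 𝒦_d`, then `jInf M ≤ jInf M′`, and if
  `jInf M′ = jInf M` then `topCount M ≤ topCount M′` (each top component keeps a non-empty open part off the support, of full dimension over a field —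
  `AuxSupportTop.topologicalKrullDim_inter_open_eq` — whose closure upstairs is a top component of `nonKillable M′`; distinct components stay distinct);
* ★★ `exists_top_subset_support_of_lex_lt` — contrapositive: a lexicographic drop `jInf′ < jInf ∨ (jInf′ = jInf ∧ topCount′ < topCount)` forces SOME
  top-dimensional component of `nonKillable M` inside the support. So the support clause of `AuxOrbitAt` is NECESSARY, exactly as the `Z`-clause of
  `AuxTopAt` is for a `jInf` drop (p618292).
-/

set_option linter.dupNamespace false

noncomputable section

universe u

open CategoryTheory Limits AlgebraicGeometry TopologicalSpace Topology
open Literature.AlgebraicGeometry.Resolution Literature.AlgebraicGeometry.RelativeSpec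
open Summit.ResolutionOfSingularities.ResolutionOfSingularities.Theorems.WildQuotientResolution.S1
open Summit.ResolutionOfSingularities.ResolutionOfSingularities.Theorems.WildQuotientResolution.S1.NodeAtlas
open Summit.ResolutionOfSingularities.ResolutionOfSingularities.Theorems.WildQuotientResolution.S1.BlowupCharts
open Summit.ResolutionOfSingularities.ResolutionOfSingularities.Theorems.WildQuotientResolution.S1.G1Proof
open Summit.ResolutionOfSingularities.ResolutionOfSingularities.Theorems.WildQuotientResolution.S1.KillableTransport
open Summit.ResolutionOfSingularities.ResolutionOfSingularities.Theorems.WildQuotientResolution.S1.KillableReverse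
open Summit.ResolutionOfSingularities.ResolutionOfSingularities.Theorems.WildQuotientResolution.S1.CompCount
open Summit.ResolutionOfSingularities.ResolutionOfSingularities.Theorems.WildQuotientResolution.S1.TopCount

namespace Summit.ResolutionOfSingularities.ResolutionOfSingularities.Theorems.WildQuotientResolution.S1

/-! ## Topology: an embedding on an open dense-in-top-components part does not lose top components -/

namespace TopCount

variable {X : Type u} {Y : Type u} [TopologicalSpace X] [TopologicalSpace Y]

/-- **Top components survive an embedding of the open part off `F`**: let `F ⊆ X` be closed, `D := Fᶜ` with the embedding `ψ : ↥D → Y`; suppose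
`dim Y ≤ k` and every top component `C` of `X` has `dim (C ∖ F) = k` (in particular meets `D`). Then `nTopComp X ≤ nTopComp Y`
(`Y` with finitely many irreducible components). [OURS · L1 W4.5c] -/
theorem nTopComp_le_of_isEmbedding_compl {F : Set X} (hF : IsClosed F) {ψ : ↥(Fᶜ) → Y} (hψ : IsEmbedding ψ) {k : ℕ}
    (hY : topologicalKrullDim Y ≤ k) (hfinY : (irreducibleComponents Y).Finite)
    (hopen : ∀ C ∈ topComponents X, topologicalKrullDim ↥(C ∩ Fᶜ) = k) : nTopComp X ≤ nTopComp Y := by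
  classical
  let ι : ↥(Fᶜ) → X := Subtype.val
  have hι : IsOpenEmbedding ι := hF.isOpen_compl.isOpenEmbedding_subtypeVal
  -- the trace of a top component on `D = Fᶜ` is a top component of `D`
  have htrace : ∀ C ∈ topComponents X, ι ⁻¹' C ∈ irreducibleComponents ↥(Fᶜ) ∧ topologicalKrullDim ↥(ι ⁻¹' C) = k := by
    intro C hC
    have hne : (C ∩ Set.range ι).Nonempty := by
      have hk : topologicalKrullDim ↥(C ∩ Fᶜ) ≠ ⊥ := by rw [hopen C hC]; exact WithBot.coe_ne_bot
      rw [Ne, topologicalKrullDim, Order.krullDim_eq_bot_iff, not_isEmpty_iff] at hk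
      obtain ⟨T⟩ := hk
      obtain ⟨⟨x, hxC, hxF⟩, -⟩ := T.isIrreducible.nonempty
      exact ⟨x, hxC, ⟨x, hxF⟩, rfl⟩
    refine ⟨preimage_mem_irreducibleComponents hC.1 hι hne, ?_⟩
    rw [← hopen C hC]
    refine IsHomeomorph.topologicalKrullDim_eq (fun z : ↥(ι ⁻¹' C) => (⟨z.1.1, z.2, z.1.2⟩ : ↥(C ∩ Fᶜ))) ?_
    rw [isHomeomorph_iff_isEmbedding_surjective]
    refine ⟨(IsEmbedding.subtypeVal.of_comp_iff).mp ?_, fun w => ⟨⟨⟨w.1, w.2.2⟩, w.2.1⟩, rfl⟩⟩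
    exact (IsEmbedding.subtypeVal.comp IsEmbedding.subtypeVal : IsEmbedding fun z : ↥(ι ⁻¹' C) => (z.1 : X))
  -- the map `C ↦ closure (ψ '' (ι⁻¹ C))`
  let Φ : Set X → Set Y := fun C => closure (ψ '' (ι ⁻¹' C))
  have hmaps : Set.MapsTo Φ (topComponents X) (topComponents Y) := fun C hC => by
    obtain ⟨hcomp, hdim⟩ := htrace C hC
    obtain ⟨hmem, hdim'⟩ := closure_image_mem_topComponents hψ hY hcomp hdim
    refine ⟨hmem, le_antisymm (topologicalKrullDim_subspace_le Y _) ?_⟩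
    rw [hdim']
    exact hY
  have hinj : Set.InjOn Φ (topComponents X) := by
    intro C₁ hC₁ C₂ hC₂ h
    have hc₁ := htrace C₁ hC₁
    have hc₂ := htrace C₂ hC₂
    have h1 := image_eq_closure_inter_range hψ (isClosed_of_mem_irreducibleComponents _ hc₁.1)
    have h2 := image_eq_closure_inter_range hψ (isClosed_of_mem_irreducibleComponents _ hc₂.1)
    have h3 : ψ '' (ι ⁻¹' C₁) = ψ '' (ι ⁻¹' C₂) := by rw [h1, h2]; exact congrArg (· ∩ Set.range ψ) h
    have h4 : ι ⁻¹' C₁ = ι ⁻¹' C₂ := hψ.injective.image_injective h3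
    -- `C = closure (ι '' ι⁻¹ C)` for a component meeting the open `D`
    have hcl : ∀ C ∈ topComponents X, C = closure (ι '' (ι ⁻¹' C)) := fun C hC => by
      have hne : (ι ⁻¹' C).Nonempty := (htrace C hC).1.1.nonempty
      exact (closure_image_preimage_of_isPreirreducible ι hι.isOpenMap C hne hC.1.1.isPreirreducible
        (isClosed_of_mem_irreducibleComponents C hC.1)).symm
    rw [hcl C₁ hC₁, hcl C₂ hC₂, h4]
  have hfin : (topComponents Y).Finite := hfinY.subset (topComponents_subset Y)
  calc nTopComp X = (topComponents X).ncard := rfl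
    _ = (Φ '' topComponents X).ncard := (hinj.ncard_image).symm
    _ ≤ (topComponents Y).ncard := Set.ncard_le_ncard hmaps.image_subset hfin
    _ = nTopComp Y := rfl

end TopCount

/-! ## Models: the embedding off the support, and the necessity -/

namespace GameFrame.GModel

open TopCount AuxSupportTop

variable {p : ℕ} {X' X₁ : Scheme.{0}} {q : X' ⟶ X₁} {G : Type} [Group G] {ρ : G →* Aut X'} {g₀ : G}

/-- ★ **THE NON-KILLABLE POINTS OFF THE SUPPORT EMBED INTO `nonKillable M′`** (the inducing map of p617035 is injective). [OURS · L1 W4.5c] -/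
theorem exists_isEmbedding_nonKillable_diff_support [Finite G] (hp : p.Prime) (hG : ∀ g : G, g ∈ Subgroup.zpowers g₀) (M M' : GModel p q G ρ g₀)
    (hB' : M'.HasNoetherianBase) (𝒦 : ReesFiltration M.V) (d : ℕ) (h𝒦G : ∀ g : G, (𝒦.ideal d).comap (M.act.aut g).hom = 𝒦.ideal d)
    (π' : M'.V ⟶ M.V) (hbl : IsBlowup π' (𝒦.ideal d)) (hr : M'.r = π' ≫ M.r) (hcomm : ∀ g : G, (M'.act.aut g).hom ≫ π' = π' ≫ (M.act.aut g).hom) :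
    ∃ ψ : ↥(M.nonKillable \ ((𝒦.ideal d).support : Set M.V)) → ↥M'.nonKillable, IsEmbedding ψ ∧ ∀ v, π'.base (ψ v).1 = v.1 := by
  have hsuppG := fun g => preimage_support_compl_of_comap_eq M (I := 𝒦.ideal d) h𝒦G g
  let W : M.V.Opens := (𝒦.ideal d).support.compl
  haveI hiso : IsIso (π' ∣_ W) := hbl.isIso_morphismRestrict (U := W) (by
    rw [Set.disjoint_iff]; rintro x ⟨hx, hx'⟩; exact hx hx')
  let e : ↥(π' ⁻¹ᵁ W) ≃ₜ ↥W := Scheme.homeoOfIso (asIso (π' ∣_ W))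
  let φ₀ : ↥(M.nonKillable \ ((𝒦.ideal d).support : Set M.V)) → M'.V := fun v => (e.symm ⟨v.1, v.2.2⟩ : ↥(π' ⁻¹ᵁ W)).1
  have hφ₀ : ∀ v, π'.base (φ₀ v) = v.1 := fun v => by
    have h1 : ((e (e.symm ⟨v.1, v.2.2⟩) : ↥W) : M.V) = v.1 := by rw [e.apply_symm_apply]
    rw [← h1]
    exact (morphismRestrict_base_coe π' W (e.symm ⟨v.1, v.2.2⟩)).symm
  have hind₀ : IsInducing φ₀ := by
    refine IsInducing.subtypeVal.comp (e.symm.isInducing.comp ?_)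
    exact (IsInducing.subtypeVal.codRestrict (fun v => v.2.2) :
      IsInducing fun v : ↥(M.nonKillable \ ((𝒦.ideal d).support : Set M.V)) => (⟨v.1, v.2.2⟩ : ↥W))
  have hinj₀ : Function.Injective φ₀ := by
    intro a b hab
    have h1 : e.symm ⟨a.1, a.2.2⟩ = e.symm ⟨b.1, b.2.2⟩ := Subtype.ext hab
    have h2 := e.symm.injective h1
    exact Subtype.ext (congrArg (fun x : ↥W => (x : M.V)) h2)
  have hmem₀ : ∀ v, φ₀ v ∈ M'.nonKillable := fun v => by
    have hvW : π'.base (φ₀ v) ∉ ((𝒦.ideal d).support : Set M.V) := by rw [hφ₀]; exact v.2.2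
    refine ⟨fun hgood => v.2.1.1 ?_, fun ⟨𝒦₂, d₂, O₂, hd₂, hvO₂, hO₂⟩ => v.2.1.2 ?_⟩
    · rw [← hφ₀ v]
      exact isGoodAt_base_of_isGoodAt hG M M' 𝒦 d π' hbl hr hcomm hsuppG hvW hgood
    · have hbad : φ₀ v ∈ M'.badLocus := fun hgood => v.2.1.1 (by
        rw [← hφ₀ v]; exact isGoodAt_base_of_isGoodAt hG M M' 𝒦 d π' hbl hr hcomm hsuppG hvW hgood)
      have hvs : φ₀ v ∈ ((𝒦₂.ideal d₂).support : Set M'.V) := g1 hp q G ρ g₀ hG M' 𝒦₂ d₂ O₂ hB' hO₂ _ hvO₂ hbad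
      rw [← hφ₀ v]
      exact killableAt_base_of_killableAt M M' 𝒦 d π' hbl hr hcomm hsuppG hvW hO₂ hd₂ hvO₂ hvs
  exact ⟨Set.codRestrict φ₀ _ hmem₀, ⟨hind₀.codRestrict hmem₀, (Set.injective_codRestrict hmem₀).mpr hinj₀⟩, fun v => hφ₀ v⟩

/-- ★★ **NO TOP COMPONENT IN THE SUPPORT ⇒ NO LEXICOGRAPHIC DROP.** Models of a datum over a field; an admissible move along a centre with `G`-stable
piece `𝒦_d`; `jInf M = k` finite. If NO irreducible component of `nonKillable M` of dimension `k` lies inside `supp 𝒦_d`, then `jInf M ≤ jInf M′` and,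
if `jInf M′ = jInf M`, `topCount M ≤ topCount M′`. [OURS · L1 W4.5c] -/
theorem topCount_le_of_forall_not_subset {kf : Type} [Field kf] (f : X₁ ⟶ Spec (.of kf)) [LocallyOfFiniteType f] [QuasiCompact f] [IsFinite q]
    [Finite G] (hp : p.Prime) (hG : ∀ g : G, g ∈ Subgroup.zpowers g₀) (M M' : GModel p q G ρ g₀) (𝒦 : ReesFiltration M.V) (d : ℕ)
    (h𝒦G : ∀ g : G, (𝒦.ideal d).comap (M.act.aut g).hom = 𝒦.ideal d) (hmv : M.IsMoveOf M' 𝒦 d) {k : ℕ} (hk : M.jInf = k)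
    (hno : ∀ C ∈ irreducibleComponents ↥M.nonKillable, topologicalKrullDim ↥C = M.jInf →
      ¬ (Subtype.val '' C ⊆ ((𝒦.ideal d).support : Set M.V))) :
    M.jInf ≤ M'.jInf ∧ (M'.jInf = M.jInf → M.topCount ≤ M'.topCount) := by
  haveI := locallyOfFiniteType_of_datum f M
  haveI := compactSpace_of_datum f M
  haveI := compactSpace_of_datum f M'
  obtain ⟨π', hbl, -, hr, hcomm⟩ := hmv
  obtain ⟨ψ, hψ, -⟩ := exists_isEmbedding_nonKillable_diff_support hp hG M M' (hasNoetherianBase_of_datum f M') 𝒦 d h𝒦G π' hbl hr hcomm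
  -- `F` := the trace of the support on `nonKillable M`; `↥Fᶜ ≃ ↥(nonKillable ∖ supp)`
  let F : Set ↥M.nonKillable := {z | (z : M.V) ∈ ((𝒦.ideal d).support : Set M.V)}
  have hF : IsClosed F := (𝒦.ideal d).support.isClosed.preimage continuous_subtype_val
  let θ : ↥(Fᶜ) → ↥(M.nonKillable \ ((𝒦.ideal d).support : Set M.V)) := fun z => ⟨z.1.1, z.1.2, z.2⟩
  have hθ : IsEmbedding θ := by
    refine (IsEmbedding.subtypeVal.of_comp_iff).mp ?_
    exact (IsEmbedding.subtypeVal.comp IsEmbedding.subtypeVal : IsEmbedding fun z : ↥(Fᶜ) => ((z.1 : ↥M.nonKillable) : M.V))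
  have hψθ : IsEmbedding (ψ ∘ θ) := hψ.comp hθ
  -- every top component has a full-dimensional open part off the support
  have hopen : ∀ C ∈ topComponents ↥M.nonKillable, topologicalKrullDim ↥(C ∩ Fᶜ) = k := by
    intro C hC
    have hCdim : topologicalKrullDim ↥C = M.jInf := hC.2
    -- the image component in `M.V`
    have hC₁cl : IsClosed (Subtype.val '' C) :=
      M.isClosed_nonKillable.isClosedEmbedding_subtypeVal.isClosedMap _ (isClosed_of_mem_irreducibleComponents C hC.1)
    have hC₁irr : IsIrreducible (Subtype.val '' C) := hC.1.1.image _ continuous_subtype_val.continuousOn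
    have hCC₁ : IsHomeomorph (fun c : ↥C => (⟨c.1.1, c.1, c.2, rfl⟩ : ↥(Subtype.val '' C))) := by
      rw [isHomeomorph_iff_isEmbedding_surjective]
      refine ⟨(IsEmbedding.subtypeVal.of_comp_iff).mp
        (show IsEmbedding (fun c : ↥C => ((c : ↥M.nonKillable) : M.V)) from IsEmbedding.subtypeVal.comp IsEmbedding.subtypeVal), ?_⟩
      rintro ⟨_, c, hc, rfl⟩
      exact ⟨⟨c, hc⟩, rfl⟩
    have hC₁dim : topologicalKrullDim ↥(Subtype.val '' C) = M.jInf := by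
      rw [← hCdim]; exact (IsHomeomorph.topologicalKrullDim_eq _ hCC₁).symm
    -- a point of `C` off the support
    have hne : (Subtype.val '' C ∩ ((((𝒦.ideal d).support.compl : M.V.Opens)) : Set M.V)).Nonempty := by
      by_contra h
      rw [Set.not_nonempty_iff_eq_empty] at h
      refine hno C hC.1 hCdim fun x hx => ?_
      by_contra hxs
      have : x ∈ Subtype.val '' C ∩ ((((𝒦.ideal d).support.compl : M.V.Opens)) : Set M.V) := ⟨hx, hxs⟩
      rw [h] at this
      exact this
    have h1 := topologicalKrullDim_inter_open_eq (M.r ≫ f) hC₁cl hC₁irr ((𝒦.ideal d).support.compl) hne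
    rw [hC₁dim, hk] at h1
    rw [← h1]
    refine IsHomeomorph.topologicalKrullDim_eq
      (fun z : ↥(C ∩ Fᶜ) => (⟨z.1.1, ⟨z.1, z.2.1, rfl⟩, z.2.2⟩ : ↥(Subtype.val '' C ∩ ((((𝒦.ideal d).support.compl : M.V.Opens)) : Set M.V)))) ?_
    rw [isHomeomorph_iff_isEmbedding_surjective]
    refine ⟨(IsEmbedding.subtypeVal.of_comp_iff).mp
      (show IsEmbedding (fun z : ↥(C ∩ Fᶜ) => ((z : ↥M.nonKillable) : M.V)) from IsEmbedding.subtypeVal.comp IsEmbedding.subtypeVal), ?_⟩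
    rintro ⟨_, ⟨c, hc, rfl⟩, hcs⟩
    exact ⟨⟨c, hc, hcs⟩, rfl⟩
  -- `jInf M ≤ jInf M′`: a top component exists and its open part embeds upstairs
  have hX : topologicalKrullDim ↥M.nonKillable = k := hk
  have hle : M.jInf ≤ M'.jInf := by
    -- pick a top component (the top count is positive since `jInf = k ≠ ⊥`)
    have hne : (topComponents ↥M.nonKillable).Nonempty := by
      by_contra h
      rw [Set.not_nonempty_iff_eq_empty] at h
      -- some component has dimension `k`: krull dimension is attained on a component (finitely many)
      have hfin := M.finite_irreducibleComponents_nonKillable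
      have hk' : (k : WithBot ℕ∞) ≤ topologicalKrullDim ↥M.nonKillable := hX.ge
      rw [topologicalKrullDim] at hk'
      have hk'' : ((k : ℕ∞) : WithBot ℕ∞) ≤ Order.krullDim (IrreducibleCloseds ↥M.nonKillable) := by exact_mod_cast hk'
      obtain ⟨l, hl⟩ := Order.le_krullDim_iff.mp hk''
      obtain ⟨C, hC, hlC⟩ := exists_mem_irreducibleComponents_subset_of_isIrreducible (l.last : Set ↥M.nonKillable) l.last.isIrreducible
      have hall : ∀ i, (l i : Set ↥M.nonKillable) ⊆ C := fun i x hx => hlC (l.monotone (Fin.le_last i) hx)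
      have hdimC : topologicalKrullDim ↥C = k := by
        refine le_antisymm ((topologicalKrullDim_subspace_le _ C).trans hX.le) ?_
        have := TopComponents.length_le_topologicalKrullDim_of_subset C l hall
        rw [hl] at this
        exact_mod_cast this
      have : C ∈ topComponents ↥M.nonKillable := ⟨hC, hdimC.trans hX.symm⟩
      rw [h] at this
      exact this
    obtain ⟨C, hC⟩ := hne
    have hg : IsInducing fun z : ↥(C ∩ Fᶜ) => ψ (θ ⟨z.1, z.2.2⟩) :=
      hψθ.isInducing.comp (IsInducing.subtypeVal.codRestrict (fun z : ↥(C ∩ Fᶜ) => z.2.2) :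
        IsInducing fun z : ↥(C ∩ Fᶜ) => (⟨z.1, z.2.2⟩ : ↥(Fᶜ)))
    have h1 : topologicalKrullDim ↥(C ∩ Fᶜ) ≤ M'.jInf := hg.topologicalKrullDim_le
    rw [hopen C hC, ← hk] at h1
    exact h1
  refine ⟨hle, fun heq => ?_⟩
  have hY : topologicalKrullDim ↥M'.nonKillable ≤ k := by rw [← hk, ← heq]; exact le_of_eq rfl
  exact nTopComp_le_of_isEmbedding_compl hF hψθ hY M'.finite_irreducibleComponents_nonKillable hopen

/-- ★★ **A LEXICOGRAPHIC DROP FORCES A TOP COMPONENT INSIDE THE SUPPORT** (contrapositive): along an admissible move of a datum model with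
`jInf′ < jInf ∨ (jInf′ = jInf ∧ topCount′ < topCount)`, SOME top-dimensional component of `nonKillable M` lies inside `supp 𝒦_d` — the support clause of
`AuxOrbitAt` is necessary. [OURS · L1 W4.5c] -/
theorem exists_top_subset_support_of_lex_lt {kf : Type} [Field kf] (f : X₁ ⟶ Spec (.of kf)) [LocallyOfFiniteType f] [QuasiCompact f] [IsFinite q]
    [Finite G] (hp : p.Prime) (hG : ∀ g : G, g ∈ Subgroup.zpowers g₀) (M M' : GModel p q G ρ g₀) (𝒦 : ReesFiltration M.V) (d : ℕ)
    (h𝒦G : ∀ g : G, (𝒦.ideal d).comap (M.act.aut g).hom = 𝒦.ideal d) (hmv : M.IsMoveOf M' 𝒦 d) {k : ℕ} (hk : M.jInf = k)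
    (hlex : M'.jInf < M.jInf ∨ (M'.jInf = M.jInf ∧ M'.topCount < M.topCount)) :
    ∃ C ∈ irreducibleComponents ↥M.nonKillable, topologicalKrullDim ↥C = M.jInf ∧ Subtype.val '' C ⊆ ((𝒦.ideal d).support : Set M.V) := by
  by_contra h
  push Not at h
  obtain ⟨hle, hcount⟩ := topCount_le_of_forall_not_subset f hp hG M M' 𝒦 d h𝒦G hmv hk fun C hC hdim => h C hC hdim
  rcases hlex with hlt | ⟨heq, hlt⟩
  · exact absurd hle (not_le_of_gt hlt)
  · exact absurd (hcount heq) (not_le_of_gt hlt)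

end GameFrame.GModel

end Summit.ResolutionOfSingularities.ResolutionOfSingularities.Theorems.WildQuotientResolution.S1

end
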